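import Literature.NumberTheory.Sieve.Maynard2016Prop92PiIdentificationM
import Literature.NumberTheory.Sieve.FGKMT2018Prop91MainTermL84
import Literature.NumberTheory.Sieve.Maynard2016DenseClustersMixedProfile
import HarnessLib

/-!
# Maynard 2016, Prop. 9.2 (𝒜 = ℤ): the sum `∑_r (y^{(m)}_r)²/φ_ω(r)` — (9.19)–(9.21), leaf M4

Source: J. Maynard, *Dense clusters of primes in subsets*, Compositio Math. 152 (2016) = arXiv:1405.2593
[Maynard2016DenseClusters], proof of Proposition 9.2, pp. 21–23: by Lemma 9.3,
`y^{(m)}_r = (log R) c_m (∫ F dt_m + O(T_k (log log R)²/log R · ∫ F₂ dt_m))` on `𝒟'_k`, `r_m = 1`, `(a_m, B) = 1`;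
squaring and summing with Lemma 8.4 in the `k − 1` coordinates `j ≠ m` (moduli `W'_j`) gives (9.19), the
`F₂`-part is `≪ k² T_k² J_k(F)` (9.20) by Lemma 8.4 at scale `R²` with the majorant `mixG²`, and «simplifying
the products in (9.19) gives (9.21)»:
`∑_{r ∈ 𝒟'_k, r_m = 1} (y^{(m)}_r)²/φ_ω(r) = (1 + O((log x)^{−1/10})) (log R)^{k+1} W^{k−1}B^{k−1}𝔖_{WB}(𝓛)
/φ(WB)^{k−1} · J_k(F) · ∏_{p ∣ a_m, p ∤ WB}(p − 1)/p`. K. Ford, B. Green, S. Konyagin, J. Maynard, T. Tao,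
*Long gaps between primes*, JAMS 31 (2018) [FordGreenKonyaginMaynardTao2018], Thm 6 (7.13) pp. 21–22 (the
`𝒜 = ℤ` frame of Prop. 6.1).

PROVED here (no named facts): **`maynard2016Prop92YSqSum_of_lemma93Z : Maynard2016Lemma93Z →
Maynard2016Prop92YSqSum`** — the DAG leaf M4 of `Maynard2016Prop92MainDecomposition` from the leaf M2
(Lemma 9.3 in the frame). Ingredients: the bridge `∑_{r} (∫F dt_m)²/φ_ω(r) = rFoldSum_{k−1}(W'; H_ψ², g̃_k²)`
and the majorant `∑_{r} (∫F₂ dt_m)²/φ_ω(r) ≤ (ℓ₂ + kℓ)² rFoldSum_{k−1}(W'; 1, mixG²; R²)`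
(`Maynard2016Prop92YSqSumBridge`), Lemma 8.4 (`MaynardDense.lemma84_all'_dec`, twice), the identification
`(log R c_m)² Π' (log R)^{k−1} J = mainCoeffM · (1 + O(1/log X))` (`Maynard2016Prop92PiIdentificationM`),
Lemma 8.6 (`J_k(F₁) ≤ 2 J_k(F)`, `(2∫mixG²)^{k−1} ≤ e⁴ γ^{k−1}`), and the size hypothesis `L ≪ (log X)^{1/10}`
for the moduli `W'_j ≤ W B E'` (`lambda84_le_of_le_mul`).

## References
* J. Maynard, *Dense clusters of primes in subsets*, Compositio Math. 152 (2016), Prop. 9.2 (9.19)–(9.21),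
  Lemma 9.3, Lemma 8.4, Lemma 8.6 [Maynard2016DenseClusters].
* K. Ford, B. Green, S. Konyagin, J. Maynard, T. Tao, *Long gaps between primes*, JAMS 31 (2018), Thm 6
  [FordGreenKonyaginMaynardTao2018].
-/

noncomputable section

open Finset Filter Topology MeasureTheory
open scoped ArithmeticFunction.Moebius

namespace Literature.NumberTheory.Sieve.FGKMT2018

variable {n k : ℕ}

/-! ### Elementary inequalities -/

/-- `log 4 ≤ 2`, `log 52 ≤ 4`. [folklore] -/
private theorem log_four_le_two_and_log_52_le_four'' : Real.log 4 ≤ 2 ∧ Real.log 52 ≤ 4 := by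
  have h := Real.exp_one_gt_d9
  have h0 := Real.exp_pos (1 : ℝ)
  have he2 : Real.exp 2 = Real.exp 1 * Real.exp 1 := by rw [← Real.exp_add]; norm_num
  have h2 : (7389 : ℝ) / 1000 ≤ Real.exp 2 := by rw [he2]; nlinarith
  constructor
  · rw [Real.log_le_iff_le_exp (by norm_num)]
    linarith
  · rw [Real.log_le_iff_le_exp (by norm_num)]
    have : Real.exp 4 = Real.exp 2 * Real.exp 2 := by rw [← Real.exp_add]; norm_num
    rw [this]; nlinarith [Real.exp_pos (2 : ℝ)]

set_option maxHeartbeats 400000 in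
/-- **The hypothesis `L` of Lemma 8.4 for moduli `≤ W B E`** (any scale `N ≤ 2X`, exponent `j ≤ k`): for
`M ≤ W B E N^j` with `log E ≤ 20 k² log X`, `k² ≤ 2 (log X)^{2/5}`: `9 + ∑_{p∣M} log p/p ≤ 29 (log X)^{1/10}`
(as `lambda84_le_gen`; used for the moduli `W'_j ≤ W B E'` of Prop. 9.2).
[cite: Maynard2016DenseClusters, Lemma 8.4 (hypothesis on L(e)) p. 16, proof of Prop. 9.2 (9.19)–(9.20) pp. 22–23; Lemma 8.1(ii)] -/
theorem lambda84_le_of_le_mul {k j : ℕ} (hk : 2 ≤ k) (hjk : j ≤ k) {B : ℕ} (hB0 : B ≠ 0) {X : ℝ} {E N M : ℕ}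
    (hX : 1 ≤ X) (hlX : 1 ≤ Real.log X) (hkX : (k : ℝ) ^ 2 ≤ 2 * Real.log X ^ ((2 : ℝ) / 5))
    (hBX : (B : ℝ) ≤ 2 * X) (hE1 : 1 ≤ E) (hlogE : Real.log E ≤ 20 * (k : ℝ) ^ 2 * Real.log X)
    (hN1 : 1 ≤ N) (hNX : (N : ℝ) ≤ 2 * X) (hM : M ≠ 0)
    (hMle : (M : ℝ) ≤ (wCut k B : ℝ) * B * E * (N : ℝ) ^ j) :
    9 + ∑ p ∈ M.primeFactors, Real.log p / p ≤ 29 * Real.log X ^ ((1 : ℝ) / 10) := by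
  obtain ⟨hlog4, hlog52⟩ := log_four_le_two_and_log_52_le_four''
  set lX := Real.log X with hlXdef
  have hlX0 : 0 < lX := by linarith
  set u := lX ^ ((1 : ℝ) / 10) with hu
  have hu1 : 1 ≤ u := Real.one_le_rpow hlX (by norm_num)
  have hk2r : (2 : ℝ) ≤ k := by exact_mod_cast hk
  have hjk' : (j : ℝ) ≤ k := by exact_mod_cast hjk
  have hk4 : (4 : ℝ) ≤ (k : ℝ) ^ 2 := by nlinarith
  have hX0 : 0 < X := by linarith
  have hlog2X : Real.log (2 * X) ≤ 2 * lX := by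
    rw [Real.log_mul (by norm_num) hX0.ne', hlXdef]
    have : Real.log 2 ≤ 1 := by have := Real.log_two_lt_d9; linarith
    linarith
  have hW1 : (1 : ℝ) ≤ (wCut k B : ℝ) := by exact_mod_cast Nat.one_le_iff_ne_zero.2 (wCut_ne_zero k B)
  have hB1 : (1 : ℝ) ≤ (B : ℝ) := by exact_mod_cast Nat.one_le_iff_ne_zero.2 hB0
  have hE1r : (1 : ℝ) ≤ (E : ℝ) := by exact_mod_cast hE1
  have hC1 : (1 : ℝ) ≤ (N : ℝ) := by exact_mod_cast hN1
  have hlogW : Real.log (wCut k B : ℝ) ≤ 4 * (k : ℝ) ^ 2 * lX := by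
    have h1 : (wCut k B : ℝ) ≤ (4 : ℝ) ^ (2 * k ^ 2) := by exact_mod_cast wCut_le_four_pow k B
    calc Real.log (wCut k B : ℝ) ≤ Real.log ((4 : ℝ) ^ (2 * k ^ 2)) := Real.log_le_log (by linarith) h1
      _ = (2 * k ^ 2 : ℕ) * Real.log 4 := by rw [Real.log_pow]
      _ ≤ (2 * k ^ 2 : ℕ) * 2 := mul_le_mul_of_nonneg_left hlog4 (Nat.cast_nonneg _)
      _ = 4 * (k : ℝ) ^ 2 * 1 := by push_cast; ring
      _ ≤ 4 * (k : ℝ) ^ 2 * lX := mul_le_mul_of_nonneg_left hlX (by positivity)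
  have hlogB : Real.log (B : ℝ) ≤ (k : ℝ) ^ 2 * lX := by
    calc Real.log (B : ℝ) ≤ Real.log (2 * X) := Real.log_le_log (by linarith) hBX
      _ ≤ 2 * lX := hlog2X
      _ ≤ (k : ℝ) ^ 2 * lX := mul_le_mul_of_nonneg_right (by linarith) hlX0.le
  have hlogC : (j : ℝ) * Real.log (N : ℝ) ≤ (k : ℝ) ^ 2 * lX := by
    have h1 : Real.log (N : ℝ) ≤ 2 * lX := (Real.log_le_log (by linarith) hNX).trans hlog2X
    have h0 : 0 ≤ Real.log (N : ℝ) := Real.log_nonneg hC1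
    calc (j : ℝ) * Real.log (N : ℝ) ≤ (k : ℝ) * Real.log (N : ℝ) := mul_le_mul_of_nonneg_right hjk' h0
      _ ≤ (k : ℝ) * (2 * lX) := mul_le_mul_of_nonneg_left h1 (by linarith)
      _ = 2 * (k : ℝ) * lX := by ring
      _ ≤ (k : ℝ) ^ 2 * lX := mul_le_mul_of_nonneg_right (by nlinarith) hlX0.le
  have hM0 : (0 : ℝ) < M := by exact_mod_cast Nat.pos_of_ne_zero hM
  have hlogM : Real.log M ≤ 26 * (k : ℝ) ^ 2 * lX := by
    have hpos : (0 : ℝ) < (wCut k B : ℝ) * B * E * (N : ℝ) ^ j := by positivity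
    calc Real.log M ≤ Real.log ((wCut k B : ℝ) * B * E * (N : ℝ) ^ j) := Real.log_le_log hM0 hMle
      _ = Real.log (wCut k B : ℝ) + Real.log B + Real.log E + j * Real.log (N : ℝ) := by
          rw [Real.log_mul (by positivity) (by positivity), Real.log_mul (by positivity) (by positivity),
            Real.log_mul (by positivity) (by positivity), Real.log_pow]
      _ ≤ 4 * (k : ℝ) ^ 2 * lX + (k : ℝ) ^ 2 * lX + 20 * (k : ℝ) ^ 2 * lX + (k : ℝ) ^ 2 * lX := by
          linarith
      _ = 26 * (k : ℝ) ^ 2 * lX := by ring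
  have h75 : lX ^ ((2 : ℝ) / 5) * lX = lX ^ ((7 : ℝ) / 5) := by
    rw [← Real.rpow_add_one hlX0.ne']; norm_num
  have hlogM' : Real.log M ≤ 52 * lX ^ ((7 : ℝ) / 5) := by
    calc Real.log M ≤ 26 * (k : ℝ) ^ 2 * lX := hlogM
      _ ≤ 26 * (2 * lX ^ ((2 : ℝ) / 5)) * lX :=
          mul_le_mul_of_nonneg_right (mul_le_mul_of_nonneg_left hkX (by norm_num)) hlX0.le
      _ = 52 * lX ^ ((7 : ℝ) / 5) := by rw [← h75]; ring
  set T := 52 * lX ^ ((13 : ℝ) / 10) with hT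
  have hT1 : 1 ≤ lX ^ ((13 : ℝ) / 10) := Real.one_le_rpow hlX (by norm_num)
  have hTpos : 0 < T := by rw [hT]; positivity
  have hT3 : 3 ≤ T := by rw [hT]; linarith
  have hsum := sum_primeFactors_log_div_le hM hT3
  have hdiv : Real.log M / T ≤ u := by
    rw [div_le_iff₀ hTpos, hu, hT]
    have : lX ^ ((1 : ℝ) / 10) * (52 * lX ^ ((13 : ℝ) / 10)) = 52 * lX ^ ((7 : ℝ) / 5) := by
      rw [mul_left_comm, ← Real.rpow_add hlX0]; norm_num
    rw [this]; exact hlogM'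
  have hlogT : Real.log T ≤ 4 + 13 * u := by
    rw [hT, Real.log_mul (by norm_num) (by positivity), Real.log_rpow hlX0]
    have h1 : Real.log lX ≤ lX ^ ((1 : ℝ) / 10) / ((1 : ℝ) / 10) := Real.log_le_rpow_div hlX0.le (by norm_num)
    rw [hu]
    have : (13 : ℝ) / 10 * Real.log lX ≤ 13 * lX ^ ((1 : ℝ) / 10) := by
      have := mul_le_mul_of_nonneg_left h1 (by norm_num : (0 : ℝ) ≤ 13 / 10)
      linarith
    linarith
  linarith

/-- The deviation hypothesis of Lemma 8.4 in dimension `k − 1 = n`, `K₁ = 2k − 1`: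
`|1 + (p − ω(p)) − p| + (k − 1) ≤ 2k − 1` (`0 ≤ ω(p) ≤ k`).
[cite: Maynard2016DenseClusters, Lemma 8.4 (hypothesis g ∈ Ω), proof of Prop. 9.2 (9.19) p. 23] -/
theorem abs_dev_omegaL_add_pred_le {L : Fin (n + 1) → ℤ × ℤ} (hadm : FormsAdmissible L) {p : ℕ}
    (hp : p.Prime) : |1 + ((p : ℝ) - omegaL L p) - p| + (n : ℝ) ≤ 2 * ((n + 1 : ℕ) : ℝ) - 1 := by
  have h1 : ((omegaL L p : ℕ) : ℝ) ≤ ((n + 1 : ℕ) : ℝ) := by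
    exact_mod_cast omegaL_le_card_of_admissible hadm hp
  rw [show (1 : ℝ) + ((p : ℝ) - omegaL L p) - p = 1 - omegaL L p by ring]
  push_cast at h1 ⊢
  rcases Nat.eq_zero_or_pos (omegaL L p) with h0 | hpos
  · rw [h0, Nat.cast_zero, sub_zero, abs_one]
    have : (0 : ℝ) ≤ n := Nat.cast_nonneg n
    linarith
  · have : (1 : ℝ) ≤ omegaL L p := by exact_mod_cast hpos
    rw [abs_of_nonpos (by linarith)]
    linarith

/-- Squaring an approximation: `|y − cI| ≤ δ c I₂` (`c, δ, I₂ ≥ 0`) gives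
`|y² − (cI)²| ≤ c²(δ(I² + I₂²) + δ² I₂²)` (via `2|I|I₂ ≤ I² + I₂²`). [folklore] -/
private theorem abs_sq_sub_sq_le {y c I I₂ δ : ℝ} (hc : 0 ≤ c) (hδ : 0 ≤ δ) (hI₂ : 0 ≤ I₂)
    (h : |y - c * I| ≤ δ * c * I₂) :
    |y ^ 2 - (c * I) ^ 2| ≤ c ^ 2 * (δ * (I ^ 2 + I₂ ^ 2) + δ ^ 2 * I₂ ^ 2) := by
  have e : y ^ 2 - (c * I) ^ 2 = (y - c * I) * ((y - c * I) + 2 * (c * I)) := by ring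
  rw [e, abs_mul]
  have h1 : |(y - c * I) + 2 * (c * I)| ≤ δ * c * I₂ + 2 * (c * |I|) := by
    calc _ ≤ |y - c * I| + |2 * (c * I)| := abs_add_le _ _
      _ ≤ δ * c * I₂ + 2 * (c * |I|) := by
          rw [abs_mul, abs_mul, abs_two, abs_of_nonneg hc]; exact add_le_add h le_rfl
  have h0 : 0 ≤ δ * c * I₂ := by positivity
  have h2 : 2 * |I| * I₂ ≤ I ^ 2 + I₂ ^ 2 := by nlinarith [sq_nonneg (|I| - I₂), sq_abs I]
  calc |y - c * I| * |y - c * I + 2 * (c * I)| ≤ (δ * c * I₂) * (δ * c * I₂ + 2 * (c * |I|)) :=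
        mul_le_mul h h1 (abs_nonneg _) h0
    _ = c ^ 2 * (δ * (2 * |I| * I₂) + δ ^ 2 * I₂ ^ 2) := by ring
    _ ≤ c ^ 2 * (δ * (I ^ 2 + I₂ ^ 2) + δ ^ 2 * I₂ ^ 2) :=
        mul_le_mul_of_nonneg_left (add_le_add (mul_le_mul_of_nonneg_left h2 hδ) le_rfl) (sq_nonneg c)

/-! ### Positivity of the constants -/

set_option maxHeartbeats 400000 in
/-- `c_m > 0` (`k = n + 1`). [cite: Maynard2016DenseClusters, Lemma 9.3 (the constant c_m) p. 21] -/
theorem cM_pos {L : Fin (n + 1) → ℤ × ℤ} (hadm : FormsAdmissible L) (hnd : FormsNondegenerate L) {B : ℕ}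
    (hB : B ≠ 0) (m : Fin (n + 1)) : 0 < cM L B m := by
  rw [cM_eq_prefactor_mul (hadm.1 m) hB]
  have hD0 : wCut (n + 1) B * B ≠ 0 := Nat.mul_ne_zero (wCut_ne_zero (n + 1) B) hB
  have hDpos : (0 : ℝ) < ((wCut (n + 1) B * B : ℕ) : ℝ) := by exact_mod_cast Nat.pos_of_ne_zero hD0
  have hφpos : (0 : ℝ) < (Nat.totient (wCut (n + 1) B * B) : ℝ) := by
    exact_mod_cast Nat.totient_pos.2 (Nat.pos_of_ne_zero hD0)
  have hS := singSeriesExcl_pos_of_nondegenerate hadm hnd (wCut (n + 1) B * B)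
  have hP : 0 < ∏ p ∈ (L m).1.natAbs.primeFactors.filter (fun p => ¬ p ∣ wCut (n + 1) B * B),
      (1 - 1 / (p : ℝ)) := Finset.prod_pos fun p hp => by
    have hp2 : (2 : ℝ) ≤ p := by
      exact_mod_cast (Nat.prime_of_mem_primeFactors (Finset.mem_filter.1 hp).1).two_le
    have : 1 / (p : ℝ) ≤ 1 / 2 := one_div_le_one_div_of_le (by norm_num) hp2
    linarith
  positivity

set_option maxHeartbeats 400000 in
/-- `mainCoeffM ≥ 0` for `R ≥ 1`, `J ≥ 0`. [cite: Maynard2016DenseClusters, Prop. 9.2 (main term) p. 21] -/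
theorem mainCoeffM_nonneg {L : Fin k → ℤ × ℤ} (hadm : FormsAdmissible L) (hnd : FormsNondegenerate L)
    (B : ℕ) {R J : ℝ} (hR : 1 ≤ R) (hJ : 0 ≤ J) (m : Fin k) : 0 ≤ mainCoeffM L B R J m := by
  unfold mainCoeffM
  have hS := (singSeriesExcl_pos_of_nondegenerate hadm hnd (wCut k B * B)).le
  have hP : 0 ≤ ∏ p ∈ (L m).1.natAbs.primeFactors.filter (fun p => ¬ p ∣ wCut k B * B),
      (((p : ℝ) - 1) / p) := Finset.prod_nonneg fun p hp => by
    have hp1 : (1 : ℝ) ≤ p := by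
      exact_mod_cast (Nat.prime_of_mem_primeFactors (Finset.mem_filter.1 hp).1).one_lt.le
    exact div_nonneg (by linarith) (by linarith)
  have hlogR := Real.log_nonneg hR
  positivity

/-! ### Lemma 8.6 inputs in dimension `k − 1` -/

/-- `(2 ∫₀^∞ mixG²)^{k−1} ≤ e⁴ γ_k^{k−1}` (`k = n + 1 ≥ 2¹⁸`; from the `k`-th power bound and `2∫mixG² ≥ γ_k`).
[cite: Maynard2016DenseClusters, proof of Lemma 8.6 («γ», «∫ h_k² ≤ T_k^{-1}»), proof of Prop. 9.2 (9.20) p. 22] -/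
theorem two_mul_setIntegral_mixG_sq_pow_pred_le (hk : 262144 ≤ n + 1) :
    (2 * ∫ u in Set.Ici (0 : ℝ), MaynardDense.mixG (n + 1) u ^ 2) ^ n ≤
      Real.exp 4 * MaynardDense.gam (n + 1) ^ n := by
  have hk2 : 2 ≤ n + 1 := le_trans (by norm_num) hk
  have hγ := MaynardDense.gam_pos hk2
  have hIG := MaynardDense.half_gam_le_setIntegral_mixG_sq hk2
  have hk' := MaynardDense.two_mul_setIntegral_mixG_sq_pow_le hk
  set IG := ∫ u in Set.Ici (0 : ℝ), MaynardDense.mixG (n + 1) u ^ 2 with hIGdef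
  have h2IG : MaynardDense.gam (n + 1) ≤ 2 * IG := by linarith
  have h0 : 0 ≤ 2 * IG := hγ.le.trans h2IG
  have h1 : (2 * IG) ^ n * MaynardDense.gam (n + 1) ≤
      Real.exp 4 * MaynardDense.gam (n + 1) ^ n * MaynardDense.gam (n + 1) := by
    calc (2 * IG) ^ n * MaynardDense.gam (n + 1) ≤ (2 * IG) ^ n * (2 * IG) :=
          mul_le_mul_of_nonneg_left h2IG (pow_nonneg h0 n)
      _ = (2 * IG) ^ (n + 1) := (pow_succ _ _).symm
      _ ≤ Real.exp 4 * MaynardDense.gam (n + 1) ^ (n + 1) := hk'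
      _ = Real.exp 4 * MaynardDense.gam (n + 1) ^ n * MaynardDense.gam (n + 1) := by ring
  exact le_of_mul_le_mul_right h1 hγ

/-- `ℓ₂ + k ℓ ≤ 2 k ℓ` (`k ≥ 2¹⁸`: `ℓ₂ T_k ≤ (5/2) log k ≤ 5 ℓ T_k`). [cite: Maynard2016DenseClusters, Lemma 8.6 (8.15)–(8.17) p. 18] -/
theorem ell₂_add_mul_ell_le (hk : 262144 ≤ k) :
    MaynardDense.ell₂ k + (k : ℝ) * MaynardDense.ell k ≤ 2 * (k : ℝ) * MaynardDense.ell k := by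
  have hk2 : 2 ≤ k := le_trans (by norm_num) hk
  have hT := MaynardDense.T_pos hk2
  have hℓ := MaynardDense.ell_pos hk2
  have h1 := MaynardDense.ell₂_mul_T_le hk
  have h2 := MaynardDense.ell_mul_T_ge hk
  have hkr : (262144 : ℝ) ≤ k := by exact_mod_cast hk
  have h3 : MaynardDense.ell₂ k * MaynardDense.T k ≤ (5 * MaynardDense.ell k) * MaynardDense.T k := by
    linarith
  have h4 : MaynardDense.ell₂ k ≤ 5 * MaynardDense.ell k := le_of_mul_le_mul_right h3 hT
  nlinarith

/-! ### Growth bookkeeping in the ranges of Proposition 6.1 -/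

set_option maxHeartbeats 400000 in
/-- In the ranges of Prop. 6.1 (`k ≤ (log x)^{1/5}`, `x/2 ≤ X ≤ x log²x`, `X^{1/30} ≤ R ≤ X^{1/9}`), eventually:
`log R ≥ 1`, `log R ≤ log X`, and `k² T_k (log log R)²/log R ≤ 24000 (log X)^{−1/10}` («we recall
`k ≤ (log x)^{1/5}` and `T_k = k log k`, so the errors appearing are `o((log x)^{−1/10})`»).
[cite: Maynard2016DenseClusters, proof of Prop. 9.2 p. 23 (the errors are o((log x)^{-1/10}))] -/
theorem eventually_prop92_growth :
    ∀ᶠ x : ℕ in atTop, ∀ k : ℕ, (k : ℝ) ≤ Real.log x ^ ((1 : ℝ) / 5) → ∀ X R : ℝ,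
      (x : ℝ) / 2 ≤ X → X ≤ x * Real.log x ^ 2 → X ^ ((1 : ℝ) / 30) ≤ R → R ≤ X ^ ((1 : ℝ) / 9) →
        1 ≤ Real.log R ∧ Real.log R ≤ Real.log X ∧
          (k : ℝ) ^ 2 * MaynardDense.T k * Real.log (Real.log R) ^ 2 / Real.log R ≤
            24000 / Real.log X ^ ((1 : ℝ) / 10) := by
  filter_upwards [eventually_prop91_main_aux 2, eventually_excProd_aux] with x hx hx' k hk X R hX1 hX2
    hR1 hR2
  obtain ⟨hXone, hlX1, h2u, -, -, hlogXR, hR2'⟩ := hx k hk X R hX1 hR1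
  obtain ⟨-, hℓX, -, -, -⟩ := hx' k hk X R hX1 hX2 hR1
  set lX := Real.log X with hlX
  set u := lX ^ ((1 : ℝ) / 10) with hu
  have hlX0 : 0 < lX := by linarith
  have hu0 : 0 < u := by rw [hu]; positivity
  have hu10 : u ^ (10 : ℕ) = lX := by
    rw [hu, ← Real.rpow_natCast, ← Real.rpow_mul hlX0.le]; norm_num
  have hlX1024 : (1024 : ℝ) ≤ lX := by
    rw [← hu10]
    calc (1024 : ℝ) = 2 ^ (10 : ℕ) := by norm_num
      _ ≤ u ^ (10 : ℕ) := pow_le_pow_left₀ (by norm_num) h2u 10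
  have hlR1 : 1 ≤ Real.log R := by linarith
  have hlR0 : 0 < Real.log R := by linarith
  have hX0 : 0 < X := by linarith
  have hRX : R ≤ X := hR2.trans (Real.rpow_le_self_of_one_le hXone (by norm_num))
  have hR0 : 0 < R := by linarith
  have hlRX : Real.log R ≤ lX := Real.log_le_log hR0 hRX
  refine ⟨hlR1, hlRX, ?_⟩
  have hk0 : (0 : ℝ) ≤ k := Nat.cast_nonneg k
  have hT : MaynardDense.T k ≤ (k : ℝ) ^ 2 := by
    have := Real.log_le_self hk0
    show (k : ℝ) * Real.log k ≤ (k : ℝ) ^ 2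
    nlinarith
  have hT0 : 0 ≤ MaynardDense.T k := by
    show (0 : ℝ) ≤ (k : ℝ) * Real.log k
    exact mul_nonneg hk0 (Real.log_natCast_nonneg k)
  set ℓ := Real.log (x : ℝ) with hℓ
  have hℓ0 : 0 ≤ ℓ := Real.log_natCast_nonneg x
  have hk4 : (k : ℝ) ^ 4 ≤ ℓ ^ ((4 : ℝ) / 5) := by
    have h := pow_le_pow_left₀ hk0 hk 4
    rw [← Real.rpow_natCast (ℓ ^ ((1 : ℝ) / 5)) 4, ← Real.rpow_mul hℓ0] at h
    norm_num at h; exact h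
  have h45 : ℓ ^ ((4 : ℝ) / 5) ≤ 2 * lX ^ ((4 : ℝ) / 5) := by
    calc ℓ ^ ((4 : ℝ) / 5) ≤ (2 * lX) ^ ((4 : ℝ) / 5) := Real.rpow_le_rpow hℓ0 hℓX (by norm_num)
      _ = (2 : ℝ) ^ ((4 : ℝ) / 5) * lX ^ ((4 : ℝ) / 5) := Real.mul_rpow (by norm_num) hlX0.le
      _ ≤ 2 * lX ^ ((4 : ℝ) / 5) :=
          mul_le_mul_of_nonneg_right (Real.rpow_le_self_of_one_le (by norm_num) (by norm_num))
            (by positivity)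
  have hk2T : (k : ℝ) ^ 2 * MaynardDense.T k ≤ 2 * lX ^ ((4 : ℝ) / 5) := by
    calc (k : ℝ) ^ 2 * MaynardDense.T k ≤ (k : ℝ) ^ 2 * (k : ℝ) ^ 2 := mul_le_mul_of_nonneg_left hT (sq_nonneg _)
      _ = (k : ℝ) ^ 4 := by ring
      _ ≤ 2 * lX ^ ((4 : ℝ) / 5) := hk4.trans h45
  have hllR0 : 0 ≤ Real.log (Real.log R) := Real.log_nonneg hlR1
  have hll : Real.log (Real.log R) ≤ 20 * lX ^ ((1 : ℝ) / 20) := by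
    calc Real.log (Real.log R) ≤ Real.log lX := Real.log_le_log hlR0 hlRX
      _ ≤ lX ^ ((1 : ℝ) / 20) / ((1 : ℝ) / 20) := Real.log_le_rpow_div hlX0.le (by norm_num)
      _ = 20 * lX ^ ((1 : ℝ) / 20) := by ring
  have hll2 : Real.log (Real.log R) ^ 2 ≤ 400 * u := by
    have h := pow_le_pow_left₀ hllR0 hll 2
    rw [mul_pow, ← Real.rpow_natCast (lX ^ ((1 : ℝ) / 20)) 2, ← Real.rpow_mul hlX0.le] at h
    norm_num at h
    rw [hu]; linarith
  have key : lX ^ ((4 : ℝ) / 5) * u = lX / u := by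
    rw [eq_div_iff hu0.ne', hu, ← Real.rpow_add hlX0, ← Real.rpow_add hlX0]
    norm_num
  rw [div_le_iff₀ hlR0]
  calc (k : ℝ) ^ 2 * MaynardDense.T k * Real.log (Real.log R) ^ 2
      ≤ (2 * lX ^ ((4 : ℝ) / 5)) * (400 * u) :=
        mul_le_mul hk2T hll2 (sq_nonneg _) (by positivity)
    _ = 800 * (lX ^ ((4 : ℝ) / 5) * u) := by ring
    _ = 800 * (lX / u) := by rw [key]
    _ ≤ 800 * (30 * Real.log R / u) := by
        refine mul_le_mul_of_nonneg_left (div_le_div_of_nonneg_right hlogXR hu0.le) (by norm_num)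
    _ = 24000 / u * Real.log R := by ring

set_option maxHeartbeats 400000 in
/-- The smallness bookkeeping `k ε ≤ C'/(log X)^{1/10}` of the two applications of Lemma 8.4
(`Λ = 29 (log X)^{1/10}`, `G_s ≤ A (k log k)² γ_k`, `k³ log²k ≤ 8 (log X)^{4/5}`, `log X ≤ 30 log R`,
`u v = log X/u` for `u = (log X)^{1/10}`, `v = (log X)^{4/5}`). [cite: Maynard2016DenseClusters, proof of Prop. 9.1 p. 20 and of Prop. 9.2 p. 23 (k T_k² L/log R = o(1))] -/
theorem keps_le_aux {k : ℕ} {C A Gs γ lR lX u v : ℝ} (hC : 0 ≤ C) (hA : 0 ≤ A) (hγ : 0 < γ)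
    (hlR : 0 < lR) (hu0 : 0 < u) (huv : u * v = lX / u)
    (hGs : Gs ≤ A * ((k : ℝ) * Real.log k) ^ 2 * γ) (hk3 : (k : ℝ) ^ 3 * Real.log k ^ 2 ≤ 8 * v)
    (hlXR : lX ≤ 30 * lR) :
    (k : ℝ) * (C * (29 * u) * Gs / (γ * lR)) ≤ 6960 * A * C / u := by
  have hk0 : (0 : ℝ) ≤ k := Nat.cast_nonneg k
  have hkGs : (k : ℝ) * Gs ≤ 8 * A * v * γ := by
    calc (k : ℝ) * Gs ≤ (k : ℝ) * (A * ((k : ℝ) * Real.log k) ^ 2 * γ) := mul_le_mul_of_nonneg_left hGs hk0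
      _ = A * ((k : ℝ) ^ 3 * Real.log k ^ 2) * γ := by ring
      _ ≤ A * (8 * v) * γ := mul_le_mul_of_nonneg_right (mul_le_mul_of_nonneg_left hk3 hA) hγ.le
      _ = 8 * A * v * γ := by ring
  rw [show (k : ℝ) * (C * (29 * u) * Gs / (γ * lR)) = C * (29 * u) * ((k : ℝ) * Gs) / (γ * lR) by ring,
    div_le_iff₀ (mul_pos hγ hlR)]
  calc C * (29 * u) * ((k : ℝ) * Gs) ≤ C * (29 * u) * (8 * A * v * γ) :=
        mul_le_mul_of_nonneg_left hkGs (by positivity)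
    _ = 232 * A * C * (u * v) * γ := by ring
    _ = 232 * A * C * (lX / u) * γ := by rw [huv]
    _ ≤ 232 * A * C * (30 * lR / u) * γ := by
        refine mul_le_mul_of_nonneg_right (mul_le_mul_of_nonneg_left
          (div_le_div_of_nonneg_right hlXR hu0.le) (by positivity)) hγ.le
    _ = 6960 * A * C / u * (γ * lR) := by ring

set_option maxHeartbeats 400000 in
/-- **The final combination of (9.19)–(9.21)** (pure bookkeeping): with `A₁ = (log R c_m)² ∑ (∫F)²/φ_ω`,
`A₂ = (log R c_m)² ∑ (∫F₂)²/φ_ω`, `M = mainCoeffM`, `c = excProdM`, the estimates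
`|Y − A₁| ≤ δ(A₁ + A₂) + δ²A₂` (Lemma 9.3 squared), `|A₁ − Mc| ≤ 244 kε · Mc` (Lemma 8.4),
`A₂ ≤ C_A k² · Mc` (Lemma 8.4 at `R²` and Lemma 8.6), `|c − 1| ≤ 1/u`, `kε ≤ C_E/u`, `δ k² ≤ C_δ/u`
give `|Y − M| ≤ K/u · M`. [cite: Maynard2016DenseClusters, proof of Prop. 9.2 (9.19)–(9.21) p. 23] -/
theorem prop92_final_combination {Y A₁ A₂ M c δ κ kε u CE Cδ CA : ℝ} (hM : 0 ≤ M) (hu : 1 ≤ u)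
    (hc : |c - 1| ≤ 1 / u) (hA₁0 : 0 ≤ A₁)
    (hY : |Y - A₁| ≤ δ * (A₁ + A₂) + δ ^ 2 * A₂)
    (hA₁ : |A₁ - M * c| ≤ 244 * kε * (M * c)) (hkε0 : 0 ≤ kε) (hkε1 : kε ≤ 1) (hkε : kε ≤ CE / u)
    (hCA : 0 ≤ CA) (hA₂ : A₂ ≤ CA * κ ^ 2 * (M * c))
    (hδ0 : 0 ≤ δ) (hCδ : 0 ≤ Cδ) (hδ : δ * κ ^ 2 ≤ Cδ / u) (hκ : 1 ≤ κ) :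
    |Y - M| ≤ (488 * CE + 1 + (490 + 2 * CA) * Cδ + 2 * CA * Cδ ^ 2) / u * M := by
  have hu0 : 0 < u := by linarith
  have hu1 : 1 / u ≤ 1 := by rw [div_le_one hu0]; exact hu
  have hc1 : c ≤ 2 := by have := (abs_le.1 hc).2; linarith
  have hc0 : 0 ≤ c := by have := (abs_le.1 hc).1; linarith
  have hMc : M * c ≤ 2 * M := by nlinarith
  have hMc0 : 0 ≤ M * c := mul_nonneg hM hc0
  have hCEu : 0 ≤ CE / u := hkε0.trans hkε
  have hCδu : 0 ≤ Cδ / u := div_nonneg hCδ hu0.le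
  -- `|Mc − M| ≤ M/u`
  have h1 : |M * c - M| ≤ 1 / u * M := by
    rw [show M * c - M = M * (c - 1) by ring, abs_mul, abs_of_nonneg hM]
    calc M * |c - 1| ≤ M * (1 / u) := mul_le_mul_of_nonneg_left hc hM
      _ = 1 / u * M := by ring
  -- `|A₁ − Mc| ≤ 488 CE M/u`
  have h2 : |A₁ - M * c| ≤ 488 * CE / u * M := by
    calc |A₁ - M * c| ≤ 244 * kε * (M * c) := hA₁
      _ ≤ 244 * (CE / u) * (2 * M) :=
          mul_le_mul (mul_le_mul_of_nonneg_left hkε (by norm_num)) hMc hMc0 (by positivity)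
      _ = 488 * CE / u * M := by ring
  -- `A₁ ≤ 490 M`, `A₂ ≤ 2 C_A κ² M`
  have hA₁le : A₁ ≤ 490 * M := by
    have h := (abs_le.1 hA₁).2
    have h' : 244 * kε * (M * c) ≤ 244 * 1 * (M * c) :=
      mul_le_mul_of_nonneg_right (mul_le_mul_of_nonneg_left hkε1 (by norm_num)) hMc0
    linarith
  have hA₂le : A₂ ≤ 2 * CA * κ ^ 2 * M := by
    calc A₂ ≤ CA * κ ^ 2 * (M * c) := hA₂
      _ ≤ CA * κ ^ 2 * (2 * M) := mul_le_mul_of_nonneg_left hMc (by positivity)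
      _ = 2 * CA * κ ^ 2 * M := by ring
  have hκ2 : 1 ≤ κ ^ 2 := one_le_pow₀ hκ
  have hδκ0 : 0 ≤ δ * κ ^ 2 := by positivity
  have hδle : δ ≤ Cδ / u := le_trans (by nlinarith) hδ
  -- `δ(A₁ + A₂) ≤ (490 + 2C_A) C_δ M/u`
  have h3 : δ * (A₁ + A₂) ≤ (490 + 2 * CA) * Cδ / u * M := by
    have e1 : δ * A₁ ≤ Cδ / u * (490 * M) := mul_le_mul hδle hA₁le hA₁0 hCδu
    have e2 : δ * A₂ ≤ δ * (2 * CA * κ ^ 2 * M) := mul_le_mul_of_nonneg_left hA₂le hδ0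
    have e3 : δ * (2 * CA * κ ^ 2 * M) = (δ * κ ^ 2) * (2 * CA * M) := by ring
    have e4 : (δ * κ ^ 2) * (2 * CA * M) ≤ (Cδ / u) * (2 * CA * M) :=
      mul_le_mul_of_nonneg_right hδ (by positivity)
    calc δ * (A₁ + A₂) = δ * A₁ + δ * A₂ := by ring
      _ ≤ Cδ / u * (490 * M) + Cδ / u * (2 * CA * M) := by linarith
      _ = (490 + 2 * CA) * Cδ / u * M := by ring
  -- `δ² A₂ ≤ 2 C_A C_δ² M/u`
  have h4 : δ ^ 2 * A₂ ≤ 2 * CA * Cδ ^ 2 / u * M := by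
    have e1 : δ ^ 2 * A₂ ≤ δ ^ 2 * (2 * CA * κ ^ 2 * M) := mul_le_mul_of_nonneg_left hA₂le (sq_nonneg δ)
    have e2 : δ ^ 2 * κ ^ 2 ≤ (δ * κ ^ 2) ^ 2 := by nlinarith [sq_nonneg δ, sq_nonneg κ]
    have e3 : (δ * κ ^ 2) ^ 2 ≤ (Cδ / u) ^ 2 := pow_le_pow_left₀ hδκ0 hδ 2
    have e4 : (Cδ / u) ^ 2 ≤ Cδ ^ 2 / u := by
      rw [div_pow]
      exact div_le_div_of_nonneg_left (sq_nonneg Cδ) hu0 (by nlinarith)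
    calc δ ^ 2 * A₂ ≤ δ ^ 2 * (2 * CA * κ ^ 2 * M) := e1
      _ = (δ ^ 2 * κ ^ 2) * (2 * CA * M) := by ring
      _ ≤ (Cδ ^ 2 / u) * (2 * CA * M) :=
          mul_le_mul_of_nonneg_right (e2.trans (e3.trans e4)) (by positivity)
      _ = 2 * CA * Cδ ^ 2 / u * M := by ring
  have htri : |Y - M| ≤ |Y - A₁| + |A₁ - M * c| + |M * c - M| := by
    have := abs_sub_le Y A₁ M
    have := abs_sub_le A₁ (M * c) M
    linarith
  calc |Y - M| ≤ |Y - A₁| + |A₁ - M * c| + |M * c - M| := htri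
    _ ≤ (δ * (A₁ + A₂) + δ ^ 2 * A₂) + 488 * CE / u * M + 1 / u * M := by linarith [hY, h2, h1]
    _ ≤ (490 + 2 * CA) * Cδ / u * M + 2 * CA * Cδ ^ 2 / u * M + 488 * CE / u * M + 1 / u * M := by
        linarith [h3, h4]
    _ = (488 * CE + 1 + (490 + 2 * CA) * Cδ + 2 * CA * Cδ ^ 2) / u * M := by ring

/-! ### Lemma 9.3 squared and summed -/

set_option maxHeartbeats 400000 in
/-- **Squaring Lemma 9.3 and summing over `r`**: if `|y^{(m)}_r − c ∫F dt_m| ≤ δ c ∫F₂ dt_m` on `𝒟'`, `r_m = 1`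
(`c = (log R) c_m ≥ 0`, `δ ≥ 0`, `∫F₂ dt_m ≥ 0`), then
`|∑ (y^{(m)}_r)²/φ_ω(r) − c² ∑ (∫F)²/φ_ω| ≤ c²(δ(∑(∫F)²/φ_ω + ∑(∫F₂)²/φ_ω) + δ² ∑(∫F₂)²/φ_ω)`.
[cite: Maynard2016DenseClusters, proof of Prop. 9.2 (9.18)⟹(9.19) p. 22 («using y^{(m)}_r ≤ … and Y_rY_s ≤ Y_r² + Y_s²»)] -/
theorem abs_ySqSumM_sub_le {L : Fin k → ℤ × ℤ} (hadm : FormsAdmissible L) {B : ℕ} {R : ℝ}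
    {F F₂ : (Fin k → ℝ) → ℝ} {m : Fin k} {c δ : ℝ} (hc : 0 ≤ c) (hδ : 0 ≤ δ)
    (hI₂ : ∀ r ∈ dkBoxP L B R m, 0 ≤ margInt m F₂ (logVec R r))
    (h : ∀ r ∈ dkBoxP L B R m,
      |yVarM L B R F m r - c * margInt m F (logVec R r)| ≤ δ * c * margInt m F₂ (logVec R r)) :
    |ySqSumM L B R F m - c ^ 2 * ∑ r ∈ dkBoxP L B R m, margInt m F (logVec R r) ^ 2 / phiOmega L (∏ i, r i)|
      ≤ c ^ 2 * (δ * (∑ r ∈ dkBoxP L B R m, margInt m F (logVec R r) ^ 2 / phiOmega L (∏ i, r i) +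
            ∑ r ∈ dkBoxP L B R m, margInt m F₂ (logVec R r) ^ 2 / phiOmega L (∏ i, r i)) +
          δ ^ 2 * ∑ r ∈ dkBoxP L B R m, margInt m F₂ (logVec R r) ^ 2 / phiOmega L (∏ i, r i)) := by
  have hφ : ∀ r ∈ dkBoxP L B R m, 0 < phiOmega L (∏ i, r i) := fun r _ =>
    phiOmega_pos_of_forall_lt L fun p hp =>
      ((formsAdmissible_iff_omegaL L).1 hadm).2 p (Nat.prime_of_mem_primeFactors hp)
  unfold ySqSumM
  rw [Finset.mul_sum, ← Finset.sum_sub_distrib]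
  have hterm : ∀ r ∈ dkBoxP L B R m,
      |yVarM L B R F m r ^ 2 / phiOmega L (∏ i, r i) -
          c ^ 2 * (margInt m F (logVec R r) ^ 2 / phiOmega L (∏ i, r i))| ≤
        c ^ 2 * δ * (margInt m F (logVec R r) ^ 2 / phiOmega L (∏ i, r i)) +
          c ^ 2 * δ * (margInt m F₂ (logVec R r) ^ 2 / phiOmega L (∏ i, r i)) +
          c ^ 2 * δ ^ 2 * (margInt m F₂ (logVec R r) ^ 2 / phiOmega L (∏ i, r i)) := by
    intro r hr
    have hφr := hφ r hr
    have key := abs_sq_sub_sq_le hc hδ (hI₂ r hr) (h r hr)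
    rw [show yVarM L B R F m r ^ 2 / phiOmega L (∏ i, r i) -
        c ^ 2 * (margInt m F (logVec R r) ^ 2 / phiOmega L (∏ i, r i)) =
        (yVarM L B R F m r ^ 2 - (c * margInt m F (logVec R r)) ^ 2) / phiOmega L (∏ i, r i) by ring,
      abs_div, abs_of_pos hφr, div_le_iff₀ hφr]
    refine key.trans (le_of_eq ?_)
    field_simp
  calc _ ≤ ∑ r ∈ dkBoxP L B R m, |yVarM L B R F m r ^ 2 / phiOmega L (∏ i, r i) -
          c ^ 2 * (margInt m F (logVec R r) ^ 2 / phiOmega L (∏ i, r i))| :=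
        Finset.abs_sum_le_sum_abs _ _
    _ ≤ ∑ r ∈ dkBoxP L B R m, (c ^ 2 * δ * (margInt m F (logVec R r) ^ 2 / phiOmega L (∏ i, r i)) +
          c ^ 2 * δ * (margInt m F₂ (logVec R r) ^ 2 / phiOmega L (∏ i, r i)) +
          c ^ 2 * δ ^ 2 * (margInt m F₂ (logVec R r) ^ 2 / phiOmega L (∏ i, r i))) :=
        Finset.sum_le_sum hterm
    _ = c ^ 2 * δ * ∑ r ∈ dkBoxP L B R m, margInt m F (logVec R r) ^ 2 / phiOmega L (∏ i, r i) +
          c ^ 2 * δ * ∑ r ∈ dkBoxP L B R m, margInt m F₂ (logVec R r) ^ 2 / phiOmega L (∏ i, r i) +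
          c ^ 2 * δ ^ 2 * ∑ r ∈ dkBoxP L B R m, margInt m F₂ (logVec R r) ^ 2 / phiOmega L (∏ i, r i) := by
        rw [Finset.sum_add_distrib, Finset.sum_add_distrib, ← Finset.mul_sum, ← Finset.mul_sum,
          ← Finset.mul_sum]
    _ = _ := by ring

end Literature.NumberTheory.Sieve.FGKMT2018

namespace Literature.NumberTheory.Sieve

open FGKMT2018

set_option maxHeartbeats 4000000 in
/-- **Maynard 2016, Proposition 9.2 (𝒜 = ℤ), (9.19)–(9.21)** — the DAG leaf M4 of
`Maynard2016Prop92MainDecomposition` from the leaf M2 (Lemma 9.3 in the frame of Prop. 6.1): for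
`(a_m, B) = 1`, `∑_{r ∈ 𝒟'_k, r_m = 1} (y^{(m)}_r)²/φ_ω(r) = (1 + O((log X)^{-1/10})) ·
(log R)^{k+1} W^{k−1}B^{k−1}𝔖_{WB}(𝓛)/φ(WB)^{k−1} · J_k(F) · ∏_{p ∣ a_m, p ∤ WB}(p − 1)/p`.
Proof: square Lemma 9.3 and sum (`abs_ySqSumM_sub_le`); the `(∫F dt_m)²`-sum is a `(k−1)`-fold
`rFoldSum` with moduli `W'_j` (`sum_margInt_F_sq_eq_rFoldSum`), evaluated by Lemma 8.4 with
`L(e) ≪ (log X)^{1/10}` (`lambda84_le_of_le_mul`, `W'_j ≤ W B E'`); the `(∫F₂ dt_m)²`-sum is `≪ k² T_k² J_k`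
(9.20) by the majorant `mixG²` at scale `R²` and Lemma 8.6; the products are identified with the main term
by `prop92_piRecM_eventually` (9.21).
[cite: Maynard2016DenseClusters, Prop. 9.2 and its proof (9.19)–(9.21) pp. 21–23; Lemma 9.3 p. 21;
Lemma 8.4 p. 16; Lemma 8.6 p. 18]
[cite: FordGreenKonyaginMaynardTao2018, Thm 6 (7.13) pp. 21–22] -/
theorem maynard2016Prop92YSqSum_of_lemma93Z : Maynard2016Lemma93Z → Maynard2016Prop92YSqSum := by
  rintro ⟨C₂, K₂, hK₂, h2⟩
  obtain ⟨C84, hC84, h84⟩ := MaynardDense.lemma84_all'_dec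
  refine ⟨max C₂ 262144,
    488 * (6960 * 3 * C84) + 1 + (490 + 2 * (24 * Real.exp 4)) * (24000 * K₂) +
      2 * (24 * Real.exp 4) * (24000 * K₂) ^ 2, by positivity, ?_⟩
  unfold Prop61Frame at h2 ⊢
  filter_upwards [h2, prop92_piRecM_eventually,
    eventually_prop91_main_aux (6960 * 3 * C84 + 6960 * 186 * C84 + 2), eventually_prop92_growth]
    with x hx2 hxB hx hxg B hB hBx k L X R hCk hk hadm hnd hcoef hX1 hX2 hR1 hR2 m hcop
  have hC₂k : C₂ ≤ k := le_trans (le_max_left _ _) hCk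
  have h18 : 262144 ≤ k := le_trans (le_max_right _ _) hCk
  obtain ⟨n, rfl⟩ : ∃ n, k = n + 1 := ⟨k - 1, by omega⟩
  have hk2 : 2 ≤ n + 1 := le_trans (by norm_num) h18
  -- the inputs: Lemma 9.3 pointwise, the `Π'`-frame, the growth facts
  have hM2 := hx2 B hB hBx (n + 1) L X R hC₂k hk hadm hnd hcoef hX1 hX2 hR1 hR2 m hcop
  obtain ⟨hXone, hlX1, hK₀u, hk2X, hk3X, hlogXR, hR2'⟩ := hx (n + 1) hk X R hX1 hR1
  obtain ⟨hlR1, hlRX, hgrowth⟩ := hxg (n + 1) hk X R hX1 hX2 hR1 hR2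
  obtain ⟨-, E, hE1, -, hlogE, hWi, hc1, hframe⟩ :=
    hxB B hB hBx n L X R hk2 hk hadm hnd hcoef hX1 hX2 hR1 hR2 m
  -- basic real facts
  have hB0 : B ≠ 0 := hB.elim (fun h => by rw [h]; exact one_ne_zero) fun h => h.ne_zero
  have hlX0 : 0 < Real.log X := by linarith
  have hlR0 : 0 < Real.log R := by linarith
  have hX0 : 0 < X := by linarith
  have hR1' : 1 < R := by linarith
  have hR0 : 0 < R := by linarith
  have hRX : R ≤ X := hR2.trans (Real.rpow_le_self_of_one_le hXone (by norm_num))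
  have hBX : (B : ℝ) ≤ 2 * X := by
    have : (B : ℝ) ≤ x := by exact_mod_cast hBx
    linarith
  have hkr2 : (2 : ℝ) ≤ ((n + 1 : ℕ) : ℝ) := by exact_mod_cast hk2
  have hkr1 : (1 : ℝ) ≤ ((n + 1 : ℕ) : ℝ) := by linarith
  have hnr : (n : ℝ) ≤ ((n + 1 : ℕ) : ℝ) := by push_cast; linarith
  have hn0 : (0 : ℝ) ≤ n := Nat.cast_nonneg n
  set u : ℝ := Real.log X ^ ((1 : ℝ) / 10) with hu
  have hu1 : 1 ≤ u := Real.one_le_rpow hlX1 (by norm_num)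
  have hu0 : 0 < u := by linarith
  have hulX : u ≤ Real.log X := Real.rpow_le_self_of_one_le hlX1 (by norm_num)
  have hCE₁0 : 0 ≤ 6960 * 3 * C84 := by positivity
  have hCE₂0 : 0 ≤ 6960 * 186 * C84 := by positivity
  have huCE₁ : 6960 * 3 * C84 ≤ u := by linarith
  have huCE₂ : 6960 * 186 * C84 ≤ u := by linarith
  have hRsq2 : 2 ≤ R ^ 2 := by
    have h := mul_le_mul hR2' hR1'.le zero_le_one hR0.le
    rw [sq]; linarith
  have hRsqX : R ^ 2 ≤ X := by
    have h1 : R ^ 2 ≤ (X ^ ((1 : ℝ) / 9)) ^ 2 := pow_le_pow_left₀ hR0.le hR2 2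
    have h2 : (X ^ ((1 : ℝ) / 9)) ^ 2 = X ^ ((2 : ℝ) / 9) := by
      rw [← Real.rpow_natCast, ← Real.rpow_mul hX0.le]; norm_num
    rw [h2] at h1
    exact h1.trans (Real.rpow_le_self_of_one_le hXone (by norm_num))
  have hlogR2 : Real.log (R ^ 2) = 2 * Real.log R := by
    rw [Real.log_pow]; norm_num
  -- test-function constants (Lemma 8.6)
  have hγ := MaynardDense.gam_pos hk2
  have hℓ := MaynardDense.ell_pos hk2
  have hℓ₂ := MaynardDense.ell₂_nonneg hk2
  have hTk := MaynardDense.T_pos hk2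
  obtain ⟨hG1, hG2, hG3, hG4, hG5, hG6, hG7⟩ := MaynardDense.lemma84_hypG_profExt_sq hk2
  obtain ⟨hΦ1, hΦ2, hΦ3⟩ := MaynardDense.lemma84_hypPhi_Hpsi_sq hk2
  obtain ⟨hM1, hM2g, hM3, hM4, hM5⟩ := MaynardDense.lemma84_hypG_mixSq hk2
  have hJ2 : MaynardDense.ell (n + 1) ^ 2 * MaynardDense.gam (n + 1) ^ n ≤
      2 * MaynardDense.JF (n + 1) := by
    have h1 := MaynardDense.orthantJ_F_ge_half h18 (Fin.last n)
    rw [MaynardDense.orthantJ_F₁ n (Fin.last n)] at h1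
    have h2 : MaynardDense.JF (n + 1) =
        MaynardDense.orthantJ n (Fin.last n) (MaynardDense.F (n + 1)) := by
      rw [MaynardDense.JF]
    rw [h2]; linarith
  have hJ0 : 0 ≤ MaynardDense.JF (n + 1) := by
    have := mul_nonneg (sq_nonneg (MaynardDense.ell (n + 1))) (pow_nonneg hγ.le n)
    linarith
  have hIGγ := MaynardDense.half_gam_le_setIntegral_mixG_sq hk2
  set IG₂ : ℝ := ∫ t in Set.Ici (0 : ℝ), MaynardDense.mixG (n + 1) t ^ 2 with hIG₂
  have hIG₂0 : 0 < IG₂ := by linarith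
  -- the moduli `W'_j` and the multiplicative function `p − ω(p)`
  set W : Fin n → ℕ := idxModM L B R m with hW
  set A : ℕ → ℝ := fun p => (p : ℝ) - omegaL L p with hA
  have hW0 : ∀ i, W i ≠ 0 := fun i => idxModM_ne_zero hnd hB0 R m i
  have hsm : ∀ i, ∀ p : ℕ, p.Prime → (p : ℝ) ≤ 2 * ((n + 1 : ℕ) : ℝ) ^ 2 → p ∣ W i :=
    fun i p hp hle => dvd_idxModM_of_le L B R m i hp (by exact_mod_cast hle)
  have hAp : ∀ p : ℕ, p.Prime → 0 < A p := fun p hp => sub_omegaL_pos hadm hp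
  have hAK : ∀ p : ℕ, p.Prime → |1 + A p - p| + (n : ℝ) ≤ 2 * ((n + 1 : ℕ) : ℝ) - 1 :=
    fun p hp => abs_dev_omegaL_add_pred_le hadm hp
  have hK₁ : 2 * ((n + 1 : ℕ) : ℝ) - 1 ≤ ((n + 1 : ℕ) : ℝ) ^ 2 := by
    have h := sq_nonneg (((n + 1 : ℕ) : ℝ) - 1); linarith
  -- the hypothesis `L ≤ 29 (log X)^{1/10}` of Lemma 8.4 at the scales `R` and `R²`
  have hΛ : ∀ R' : ℝ, 2 ≤ R' → R' ≤ X → ∀ i, ∀ M : ℕ, M ≠ 0 →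
      (M : ℝ) ≤ (W i : ℝ) * (⌈R'⌉₊ : ℝ) ^ n → 9 + ∑ p ∈ M.primeFactors, Real.log p / p ≤ 29 * u := by
    intro R' hR'2 hR'X i M hM hMle
    have hR'0 : 0 < R' := by linarith
    have hN1 : 1 ≤ ⌈R'⌉₊ := Nat.one_le_iff_ne_zero.2 (Nat.ceil_pos.2 hR'0).ne'
    have hNX : ((⌈R'⌉₊ : ℕ) : ℝ) ≤ 2 * X := by
      have := Nat.ceil_lt_add_one hR'0.le
      linarith
    refine lambda84_le_of_le_mul hk2 (Nat.le_succ n) hB0 hXone hlX1 hk2X hBX hE1 hlogE hN1 hNX hM ?_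
    calc (M : ℝ) ≤ (W i : ℝ) * (⌈R'⌉₊ : ℝ) ^ n := hMle
      _ ≤ ((wCut (n + 1) B * B * E : ℕ) : ℝ) * (⌈R'⌉₊ : ℝ) ^ n :=
          mul_le_mul_of_nonneg_right (by exact_mod_cast hWi i) (by positivity)
      _ = (wCut (n + 1) B : ℝ) * B * E * (⌈R'⌉₊ : ℝ) ^ n := by push_cast; ring
  -- smallness `k ε ≤ C/(log X)^{1/10} ≤ 1` for both applications
  have huv : u * Real.log X ^ ((4 : ℝ) / 5) = Real.log X / u := by
    rw [eq_div_iff hu0.ne', hu, ← Real.rpow_add hlX0, ← Real.rpow_add hlX0]; norm_num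
  set Gs₁ : ℝ := 2 * (1 + 30 / MaynardDense.U (n + 1) + MaynardDense.T (n + 1)) with hGs₁
  have hGs₁b : Gs₁ ≤ 3 * (((n + 1 : ℕ) : ℝ) * Real.log ((n + 1 : ℕ) : ℝ)) ^ 2 *
      MaynardDense.gam (n + 1) := two_mul_Gs_le h18
  have hGs₁0 : 0 ≤ Gs₁ := le_trans (by positivity) (hG5 0 ⟨le_rfl, zero_le_one⟩)
  have hε₁0 : 0 ≤ C84 * (29 * u) * Gs₁ / (MaynardDense.gam (n + 1) * Real.log R) := by positivity
  set kε : ℝ := ((n + 1 : ℕ) : ℝ) * (C84 * (29 * u) * Gs₁ / (MaynardDense.gam (n + 1) * Real.log R))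
    with hkε
  have hkεb : kε ≤ 6960 * 3 * C84 / u :=
    keps_le_aux hC84 (by norm_num) hγ hlR0 hu0 huv hGs₁b hk3X hlogXR
  have hkε0 : 0 ≤ kε := mul_nonneg (by positivity) hε₁0
  have hkε1 : kε ≤ 1 := hkεb.trans (by rw [div_le_one hu0]; exact huCE₁)
  have hsmall₁ : (n : ℝ) * (C84 * (29 * u) * Gs₁ / (MaynardDense.gam (n + 1) * Real.log R)) ≤ 1 :=
    le_trans (mul_le_mul_of_nonneg_right hnr hε₁0) hkε1
  have hGs₂b : MaynardDense.GsMix (n + 1) ≤ 186 * (((n + 1 : ℕ) : ℝ) * Real.log ((n + 1 : ℕ) : ℝ)) ^ 2 *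
      MaynardDense.gam (n + 1) := by
    have := MaynardDense.GsMix_le hk2
    linarith
  have hGs₂0 : 0 ≤ MaynardDense.GsMix (n + 1) := le_trans (by positivity) (hM5 0 ⟨le_rfl, zero_le_one⟩)
  have hε₂b : ((n + 1 : ℕ) : ℝ) * (C84 * (29 * u) * MaynardDense.GsMix (n + 1) /
      (MaynardDense.gam (n + 1) * Real.log R)) ≤ 6960 * 186 * C84 / u :=
    keps_le_aux hC84 (by norm_num) hγ hlR0 hu0 huv hGs₂b hk3X hlogXR
  have hε₂le : C84 * (29 * u) * MaynardDense.GsMix (n + 1) / (IG₂ * Real.log (R ^ 2)) ≤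
      C84 * (29 * u) * MaynardDense.GsMix (n + 1) / (MaynardDense.gam (n + 1) * Real.log R) := by
    apply div_le_div_of_nonneg_left (by positivity) (mul_pos hγ hlR0)
    rw [hlogR2]
    have h := mul_le_mul_of_nonneg_right (show MaynardDense.gam (n + 1) ≤ 2 * IG₂ by linarith) hlR0.le
    linarith
  have hε₂0 : 0 ≤ C84 * (29 * u) * MaynardDense.GsMix (n + 1) / (IG₂ * Real.log (R ^ 2)) := by
    rw [hlogR2]; positivity
  have hsmall₂ : (n : ℝ) * (C84 * (29 * u) * MaynardDense.GsMix (n + 1) / (IG₂ * Real.log (R ^ 2))) ≤ 1 := by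
    have h1 : ((n + 1 : ℕ) : ℝ) * (C84 * (29 * u) * MaynardDense.GsMix (n + 1) /
        (MaynardDense.gam (n + 1) * Real.log R)) ≤ 1 :=
      hε₂b.trans (by rw [div_le_one hu0]; exact huCE₂)
    calc (n : ℝ) * (C84 * (29 * u) * MaynardDense.GsMix (n + 1) / (IG₂ * Real.log (R ^ 2)))
        ≤ ((n + 1 : ℕ) : ℝ) * (C84 * (29 * u) * MaynardDense.GsMix (n + 1) / (IG₂ * Real.log (R ^ 2))) :=
          mul_le_mul_of_nonneg_right hnr hε₂0
      _ ≤ ((n + 1 : ℕ) : ℝ) * (C84 * (29 * u) * MaynardDense.GsMix (n + 1) /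
            (MaynardDense.gam (n + 1) * Real.log R)) := mul_le_mul_of_nonneg_left hε₂le (by positivity)
      _ ≤ 1 := h1
  -- Lemma 8.4 for `∑ (∫F dt_m)²/φ_ω` (scale `R`, `Φ = H_ψ²`, `G = g̃²`)
  obtain ⟨hPr0, hSF⟩ := h84 n W ((n + 1 : ℕ) : ℝ) (2 * ((n + 1 : ℕ) : ℝ) - 1) A
    (fun t => MaynardDense.profExt (n + 1) t ^ 2) (fun x => MaynardDense.Hpsi (n + 1) x ^ 2) Gs₁
    (MaynardDense.gam (n + 1)) (MaynardDense.ell (n + 1) ^ 2) (60 * MaynardDense.ell (n + 1) ^ 2)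
    (29 * u) R 0 hkr2 hK₁ hW0 hsm hAp hAK hG1 hG2 hG3 hG4 hG5 hG6 hG7 hΦ1 hΦ2 hΦ3 hR2'
    (hΛ R hR2' hRX) hsmall₁
  rw [MaynardDense.orthInt_profExt_sq_Hpsi_sq n hk2] at hSF
  -- Lemma 8.4 for the majorant of `∑ (∫F₂ dt_m)²/φ_ω` (scale `R²`, `Φ ≡ 1`, `G = mixG²`)
  obtain ⟨-, hS2⟩ := h84 n W ((n + 1 : ℕ) : ℝ) (2 * ((n + 1 : ℕ) : ℝ) - 1) A
    (fun t => MaynardDense.mixG (n + 1) t ^ 2) (fun _ => (1 : ℝ)) (MaynardDense.GsMix (n + 1)) IG₂ 1 0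
    (29 * u) (R ^ 2) 0 hkr2 hK₁ hW0 hsm hAp hAK hM1 hM2g hM3 hM4 hM5 hIG₂.symm hIG₂0 contDiff_const
    (fun x => by simp) (fun x => by simp) hRsq2 (hΛ (R ^ 2) hRsq2 hRsqX) hsmall₂
  have hoi : MaynardDense.orthInt n (fun t => MaynardDense.mixG (n + 1) t ^ 2) (fun _ => (1 : ℝ)) 0 =
      IG₂ ^ n := by
    rw [MaynardDense.orthInt_one_eq_pow]
  rw [hoi] at hS2
  -- Lemma 9.3 squared and summed
  have hcM := cM_pos hadm hnd hB0 m
  have hc₀0 : 0 ≤ Real.log R * cM L B m := (mul_pos hlR0 hcM).le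
  set δ : ℝ := K₂ * MaynardDense.T (n + 1) * Real.log (Real.log R) ^ 2 / Real.log R with hδ
  have hδ0 : 0 ≤ δ := by rw [hδ]; positivity
  have hφ : ∀ r ∈ dkBoxP L B R m, 0 < phiOmega L (∏ i, r i) := fun r _ =>
    phiOmega_pos_of_forall_lt L fun p hp =>
      ((formsAdmissible_iff_omegaL L).1 hadm).2 p (Nat.prime_of_mem_primeFactors hp)
  have hI₂ : ∀ r ∈ dkBoxP L B R m, 0 ≤ margInt m (MaynardDense.F₂ (n + 1)) (logVec R r) := by
    intro r hr
    have hbox := Fintype.mem_piFinset.1 (dkBox_subset_piFinset L B R (mem_dkBoxP_iff.1 hr).1)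
    have h := (margInt_F₂_insertNth_le hk2 m hR1' (s := Fin.removeNth m r)
      (fun j => (Finset.mem_Icc.1 (hbox (m.succAbove j))).1)).1
    rwa [insertNth_one_removeNth_of_mem hr] at h
  have hM2' : ∀ r ∈ dkBoxP L B R m,
      |yVarM L B R (MaynardDense.F (n + 1)) m r -
          Real.log R * cM L B m * margInt m (MaynardDense.F (n + 1)) (logVec R r)| ≤
        δ * (Real.log R * cM L B m) * margInt m (MaynardDense.F₂ (n + 1)) (logVec R r) := by
    intro r hr
    refine (hM2 r hr).trans (le_of_eq ?_)
    rw [hδ]; field_simp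
  have hY := abs_ySqSumM_sub_le hadm hc₀0 hδ0 hI₂ hM2'
  -- the two bridges to `rFoldSum`
  have hbrF : (∑ r ∈ dkBoxP L B R m,
      margInt m (MaynardDense.F (n + 1)) (logVec R r) ^ 2 / phiOmega L (∏ i, r i)) =
      MaynardDense.rFoldSum n W A (fun x => MaynardDense.Hpsi (n + 1) x ^ 2)
        (fun t => MaynardDense.profExt (n + 1) t ^ 2) R 0 :=
    sum_margInt_F_sq_eq_rFoldSum hk2 L B hR1' m
  have hbr₂ : (∑ r ∈ dkBoxP L B R m,
      margInt m (MaynardDense.F₂ (n + 1)) (logVec R r) ^ 2 / phiOmega L (∏ i, r i)) ≤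
      (MaynardDense.ell₂ (n + 1) + (n + 1 : ℕ) * MaynardDense.ell (n + 1)) ^ 2 *
        MaynardDense.rFoldSum n W A (fun _ => 1) (fun t => MaynardDense.mixG (n + 1) t ^ 2) (R ^ 2) 0 :=
    sum_margInt_F₂_sq_le_rFoldSum hk2 hadm B hR1' m
  rw [← hbrF] at hSF
  have hSF0 : 0 ≤ ∑ r ∈ dkBoxP L B R m,
      margInt m (MaynardDense.F (n + 1)) (logVec R r) ^ 2 / phiOmega L (∏ i, r i) :=
    Finset.sum_nonneg fun r hr => div_nonneg (sq_nonneg _) (hφ r hr).le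
  have hMC0 : 0 ≤ mainCoeffM L B R (MaynardDense.JF (n + 1)) m :=
    mainCoeffM_nonneg hadm hnd B hR1'.le hJ0 m
  have hcx : |excProdM L m (wCut (n + 1) B * B) ⌊R⌋₊ E - 1| ≤ 1 / u :=
    hc1.trans (one_div_le_one_div_of_le hu0 hulX)
  have hk2ℓ : (MaynardDense.ell₂ (n + 1) + ((n + 1 : ℕ) : ℝ) * MaynardDense.ell (n + 1)) ^ 2 ≤
      (2 * ((n + 1 : ℕ) : ℝ) * MaynardDense.ell (n + 1)) ^ 2 :=
    pow_le_pow_left₀ (by positivity) (ell₂_add_mul_ell_le h18) 2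
  have hpow : Real.log (R ^ 2) ^ n * IG₂ ^ n ≤
      Real.log R ^ n * (Real.exp 4 * MaynardDense.gam (n + 1) ^ n) := by
    rw [hlogR2, show (2 * Real.log R) ^ n * IG₂ ^ n = Real.log R ^ n * (2 * IG₂) ^ n by
      rw [mul_pow, mul_pow]; ring]
    exact mul_le_mul_of_nonneg_left (two_mul_setIntegral_mixG_sq_pow_pred_le h18)
      (pow_nonneg hlR0.le n)
  -- abbreviations for the final bookkeeping
  set Pr : ℝ := MaynardDense.piRec n W A with hPr
  set SF : ℝ := ∑ r ∈ dkBoxP L B R m,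
      margInt m (MaynardDense.F (n + 1)) (logVec R r) ^ 2 / phiOmega L (∏ i, r i) with hSFdef
  set S₂ : ℝ := ∑ r ∈ dkBoxP L B R m,
      margInt m (MaynardDense.F₂ (n + 1)) (logVec R r) ^ 2 / phiOmega L (∏ i, r i) with hS₂def
  set S₂' : ℝ := MaynardDense.rFoldSum n W A (fun _ => 1) (fun t => MaynardDense.mixG (n + 1) t ^ 2)
    (R ^ 2) 0 with hS₂'def
  set J : ℝ := MaynardDense.JF (n + 1) with hJ
  set MC : ℝ := mainCoeffM L B R J m with hMC
  set cx : ℝ := excProdM L m (wCut (n + 1) B * B) ⌊R⌋₊ E with hcxdef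
  set c₀ : ℝ := Real.log R * cM L B m with hc₀
  set γ : ℝ := MaynardDense.gam (n + 1) with hγdef
  set ℓ : ℝ := MaynardDense.ell (n + 1) with hℓdef
  set κ : ℝ := ((n + 1 : ℕ) : ℝ) with hκ
  set lR : ℝ := Real.log R with hlR
  have hid : c₀ ^ 2 * (Pr * lR ^ n * J) = MC * cx := hframe J
  have hPrL0 : 0 ≤ c₀ ^ 2 * (Pr * lR ^ n) :=
    mul_nonneg (sq_nonneg _) (mul_nonneg hPr0 (pow_nonneg hlR0.le n))
  -- `|A₁ − MC·c| ≤ 244 kε · MC·c`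
  have hnε : (n : ℝ) * (C84 * (29 * u) * Gs₁ / (γ * lR)) ≤ kε := mul_le_mul_of_nonneg_right hnr hε₁0
  have hA₁ : |c₀ ^ 2 * SF - MC * cx| ≤ 244 * kε * (MC * cx) := by
    rw [← hid, ← mul_sub, abs_mul, abs_of_nonneg (sq_nonneg c₀)]
    calc c₀ ^ 2 * |SF - Pr * lR ^ n * J|
        ≤ c₀ ^ 2 * (2 * ((n : ℝ) * (C84 * (29 * u) * Gs₁ / (γ * lR))) *
            (Pr * lR ^ n * γ ^ n * (ℓ ^ 2 + 60 * ℓ ^ 2))) :=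
          mul_le_mul_of_nonneg_left hSF (sq_nonneg _)
      _ = 122 * ((n : ℝ) * (C84 * (29 * u) * Gs₁ / (γ * lR))) *
            (c₀ ^ 2 * (Pr * lR ^ n) * (ℓ ^ 2 * γ ^ n)) := by ring
      _ ≤ 122 * kε * (c₀ ^ 2 * (Pr * lR ^ n) * (2 * J)) :=
          mul_le_mul (mul_le_mul_of_nonneg_left hnε (by norm_num))
            (mul_le_mul_of_nonneg_left hJ2 hPrL0) (mul_nonneg hPrL0 (by positivity)) (by positivity)
      _ = 244 * kε * (c₀ ^ 2 * (Pr * lR ^ n * J)) := by ring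
  -- `A₂ ≤ 24 e⁴ k² · MC·c`
  have hS2' : S₂' ≤ 3 * (Pr * Real.log (R ^ 2) ^ n * IG₂ ^ n) := by
    have h0 : 0 ≤ Pr * Real.log (R ^ 2) ^ n * IG₂ ^ n :=
      mul_nonneg (mul_nonneg hPr0 (pow_nonneg (by rw [hlogR2]; positivity) n)) (pow_nonneg hIG₂0.le n)
    have h1 := (abs_sub_le_iff.1 hS2).1
    have h2 : (n : ℝ) * (C84 * (29 * u) * MaynardDense.GsMix (n + 1) / (IG₂ * Real.log (R ^ 2))) *
        (Pr * Real.log (R ^ 2) ^ n * IG₂ ^ n) ≤ 1 * (Pr * Real.log (R ^ 2) ^ n * IG₂ ^ n) :=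
      mul_le_mul_of_nonneg_right hsmall₂ h0
    linarith
  have hS2'' : S₂' ≤ 3 * (Pr * (lR ^ n * (Real.exp 4 * γ ^ n))) := by
    have := mul_le_mul_of_nonneg_left hpow hPr0
    linarith
  have hA₂ : c₀ ^ 2 * S₂ ≤ 24 * Real.exp 4 * κ ^ 2 * (MC * cx) := by
    rw [← hid]
    have h3 : 0 ≤ 3 * (Pr * (lR ^ n * (Real.exp 4 * γ ^ n))) := by positivity
    calc c₀ ^ 2 * S₂
        ≤ c₀ ^ 2 * ((2 * κ * ℓ) ^ 2 * (3 * (Pr * (lR ^ n * (Real.exp 4 * γ ^ n))))) := by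
          refine mul_le_mul_of_nonneg_left (hbr₂.trans ?_) (sq_nonneg _)
          exact (mul_le_mul_of_nonneg_left hS2'' (sq_nonneg _)).trans
            (mul_le_mul_of_nonneg_right hk2ℓ h3)
      _ = 12 * Real.exp 4 * κ ^ 2 * (c₀ ^ 2 * (Pr * lR ^ n) * (ℓ ^ 2 * γ ^ n)) := by ring
      _ ≤ 12 * Real.exp 4 * κ ^ 2 * (c₀ ^ 2 * (Pr * lR ^ n) * (2 * J)) :=
          mul_le_mul_of_nonneg_left (mul_le_mul_of_nonneg_left hJ2 hPrL0) (by positivity)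
      _ = 24 * Real.exp 4 * κ ^ 2 * (c₀ ^ 2 * (Pr * lR ^ n * J)) := by ring
  -- `δ k² ≤ 24000 K₂/u`
  have hδκ : δ * κ ^ 2 ≤ 24000 * K₂ / u := by
    have e : δ * κ ^ 2 = K₂ * (κ ^ 2 * MaynardDense.T (n + 1) * Real.log lR ^ 2 / lR) := by
      rw [hδ]; ring
    rw [e]
    calc K₂ * (κ ^ 2 * MaynardDense.T (n + 1) * Real.log lR ^ 2 / lR) ≤ K₂ * (24000 / u) :=
          mul_le_mul_of_nonneg_left hgrowth hK₂.le
      _ = 24000 * K₂ / u := by ring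
  have hY' : |ySqSumM L B R (MaynardDense.F (n + 1)) m - c₀ ^ 2 * SF| ≤
      δ * (c₀ ^ 2 * SF + c₀ ^ 2 * S₂) + δ ^ 2 * (c₀ ^ 2 * S₂) := hY.trans (le_of_eq (by ring))
  exact prop92_final_combination hMC0 hu1 hcx (mul_nonneg (sq_nonneg _) hSF0) hY' hA₁ hkε0 hkε1 hkεb
    (by positivity) hA₂ hδ0 (by positivity) hδκ hkr1

end Literature.NumberTheory.Sieve
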